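import Literature.Barriers.PneNP.LocalityProofs
import Literature.Barriers.PneNP.LocalityE1Proofs
import HarnessLib

/-!
# Barrier `Locality_parityLocalizes` (E3^𝒪): the exact reach of the localized parity bound
(D-0021 barrier audit of `LocalityProofs.lean`, 2026-08-16)

The catalogue entry `Literature.Barriers.PneNP.Locality` (CHOPRS Prop. 50, E1^𝒪; file
`Locality.lean`) names as its companion the fact `Locality_parityLocalizes` (E3^𝒪, "Extension of
Lower Bound Techniques: `Parity ∉ (AC⁰)^𝒪[poly(n)]` if the total number of input wires in the
circuit feeding the `𝒪`-gates is `n/(log n)^{ω(1)}`", arXiv:1911.08297 p. 27), discharged in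
`LocalityProofs.lean` (`Locality_parityLocalizes_holds`). This file is the record of the barrier
audit of that discharge. Verdict: **CONFIRMED** — and quantified from both sides.

**(i) The fact is a theorem, faithful to print.** `Locality_parityLocalizes_holds` is
kernel-checked with axioms `propext, Classical.choice, Quot.sound`; its statement is a
consequence of the printed E3^𝒪 (constant depth `d`, any polynomial size, the class constraints
imposed at every length, `n/(log n)^{ω(1)}` rendered as "`w(n) ⌊log₂ n⌋^j ≤ n` eventually for
every `j`"). The printed proof is a pointer (interactive compression games, Oliveira–Santhanam
CCC 2015, plus Chattopadhyay–Santhanam FOCS 2012); the tree's proof guesses the `≤ w(n)` oracle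
wires and applies Tal's Fourier-tail bound. Both arguments are oracle-agnostic, which is the
point of a localization.

**(ii) What the tree's proof really gives (proved here: `Locality_parityLocalizes_sharp`).** The
oracle clause `IsOver (acBasis ∪ {𝒪-gates})` is never used and only the exponents `j = 0` and
`j = d + 1` of the budget are: for every depth `d`, NO family of depth-`d` polynomial-size
circuits whose gates outside `{∧, ∨, ¬}` are ARBITRARY Boolean gates (any truth tables, pairwise
different allowed — "arbitrarily powerful, possibly different oracles" in the wording of
Pich 2024, Thm. 5) of total fan-in `w(n)` with `w(n) ⌊log₂ n⌋^{d+1} ≤ n` eventually decides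
`PARITY`. The catalogued fact is its corollary (see that theorem's docstring). So the
barrier is STRONGER than catalogued: a route cannot slip past E3^𝒪 by using several different
oracles, non-language gates, or a wire budget between `n/(log n)^{ω(1)}` and `n/(log₂ n)^{d+1}`.

**(iii) The budget hypothesis is load-bearing, and the threshold is `n/(log n)^{Θ(d)}` (proved
here).** `Locality_parityLocalizes_false_without_wireBudget`: with the budget clause dropped the
statement is false (`𝒪 = PARITY`, one `PARITY`-gate of fan-in `n`: depth `1`, size `1`).
`Locality_parityLocalizes_false_at_logBudget`: already with `w(n) ⌊log₂ n⌋ ≤ n` for ALL `n`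
(`w(n) ≈ n/(2 log₂ n)`) there is a DEPTH-`3` polynomial-size family over `∧, ∨, ¬` and
`PARITY`-gates of total oracle fan-in `≤ w(n)` deciding `PARITY` (block parities of
`2(⌊log₂ n⌋+1)` consecutive variables by DNFs, one `PARITY`-gate on top:
`ParityUpper.exists_localAC_parity`). Hence "for every `j`" cannot be replaced by `j = 1`; at
depth `3` the critical exponent of `log n` lies in `[1, 4]`, and in general the random-restriction
bound localizes for total oracle fan-in `n/(log n)^{Θ(d)}` and not beyond — print's uniform
`ω(1)` is the right rendering across constant depths (cf. the remark after the proof of Prop. 50,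
p. 27: once the oracle gate is fed by literals "one can fix just `(log n)^{O(C)}` input variables
and eliminate this gate").

**(iv) Technique coverage and literature (no evasion at Frontier-E parameters found).** What a
localization formally certifies is oracle-INSENSITIVITY of one lower-bound proof; E3^𝒪 certifies
it for the switching-lemma/Fourier-tail proof of `Parity ∉ AC⁰`, at total fan-in far above the
ONE gate of fan-in `(log n)^{4C}` produced by E1^𝒪 (`Locality_holds`). The coverage caveats of
the technique slugs (print localizes A3–E3 and A4–D4 but not the monotone E4; Razborov–Smolensky
localizes, CHOPRS §5.1.1 p. 23; Razborov's approximation method with inessential variables is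
localized only with loss `poly(k d n (2^{m/d}+1))`, Pich 2024 Thm. 5, the `poly(n 2^{m^{O(1/d)}})`
regime being open, ibid. §1.3; whether random restrictions sit inside the approximation framework
is open, ibid. §1.3 "Random restrictions as the approximation method") and the later
non-localizable magnification theorems (uniform: Oliveira 2019; Atserias–Müller 2025 Thm. 11;
learning / meta-computational: Pich 2022 §6) are recorded in the `scope_caveats:` /
`evasions_known:` lines of the block in `Locality.lean` (sibling audit of the same day) and are not
repeated here; a uniform-setting confirmation of the barrier's logic is Modanese (CSR 2021, LNCS
12730, §6 "The proof of Theorem 24 and the locality barrier"). Searches run for this audit: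
`lit search` (arXiv) "locality barrier hardness magnification" → CHOPRS, Pich 2024;
`lit galaxy search "locality barrier" --star all` → Atserias–Müller 2025, Pich's 2021 research
statement, Modanese 2021; OpenAlex / Semantic Scholar rate-limited (HTTP 429) on 2026-08-16.

No narrowing, no refutation; no idea-card seed is filed from this audit (the one Frontier-E
opening — the depth-restricted monotone simulation, outside the localizing class by
`Locality.not_oracle_monotone_simulation` — is the sibling audit's).

## Sources

* [arXiv191108297] L. Chen, S. Hirahara, I. C. Oliveira, J. Pich, N. Rajgopal, R. Santhanam,
  *Beyond natural proofs: hardness magnification and locality*, ITCS 2020 / J. ACM 69 (2022):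
  Prop. 50 (E1^𝒪, E3^𝒪) with proof and the remark after it, p. 27; §1.3 pp. 6–8; Def. 11 p. 11;
  §5.1.1 p. 23 (held: `paper:arxiv-1911.08297`, pages as materialised).
* [Pich2024] J. Pich, *Localizability of the approximation method*, comput. complexity 33 (2024),
  arXiv:2212.09285: Thm. 1 / Thm. 5, Thm. 3, §1.3 (open problems), p. 4–6 and p. 14 of the
  arXiv version (held: `paper:arxiv-2212.09285`).
* [AtseriasMuller2025] A. Atserias, M. Müller, *Simple general magnification of circuit lower
  bounds*, preprint June 2025: Thm. 11 and §4.2.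
* [Modanese2021] A. Modanese, *Lower bounds and hardness magnification for sublinear-time
  shrinking cellular automata*, CSR 2021 (LNCS 12730): §6.
* [Tal2017] A. Tal, *Tight bounds on the Fourier spectrum of AC⁰*, CCC 2017: Thm. 3.6 (the tree's
  `ACForm.tailWeight_le_tailBound`).
-/

noncomputable section

open Classical Filter Finset Literature.Computability.Complexity

namespace Literature.Barriers.PneNP

/-! ### What the tree's proof of E3^𝒪 actually delivers: oracle-free, per-depth budget -/

open ParityLocalizes in
/-- **E3^𝒪, sharp form (proved).** For every depth `d`, polynomial size bound `p` and wire
budget `w` with `w(n) · ⌊log₂ n⌋^{d+1} ≤ n` for all large `n`, no family of depth-`d`,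
size-`p(n)` circuits whose gates outside the `∧, ∨, ¬` basis — ARBITRARY Boolean gates, not
necessarily slices of one oracle language, possibly pairwise different — have total fan-in
`≤ w(n)` decides `PARITY`. Compared with the catalogued `Locality_parityLocalizes`
(CHOPRS Prop. 50, E3^𝒪: one oracle language `𝒪`, budget `n/(log n)^{ω(1)}`), the oracle
structure is dropped and the budget is the per-depth `n/(log₂ n)^{d+1}`; the proof is the one of
`Locality_parityLocalizes_holds` (guessing the oracle wires + Tal's Fourier-tail bound), which
never used the oracle clause and only the exponents `j = 0` and `j = d + 1` of the budget. The
catalogued fact is the special case "gates outside `acBasis` = slices of one language, budget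
hypothesis at `j = d + 1`": `fun 𝒪 d p w hw ⟨E, hE, hdec⟩ =>
Locality_parityLocalizes_sharp d p w (hw (d + 1)) ⟨E, fun n => (hE n).2, hdec⟩` re-proves
`Locality_parityLocalizes_holds`. [cite: arXiv191108297, Prop. 50 (E3^𝒪) with proof, p. 27] -/
theorem Locality_parityLocalizes_sharp (d : ℕ) (p : Polynomial ℕ) (w : ℕ → ℕ)
    (hw : ∀ᶠ n : ℕ in atTop, w n * Nat.log 2 n ^ (d + 1) ≤ n) :
    ¬ ∃ E : CircuitFamily,
        (∀ n, (E n).acDepth ≤ d ∧ (E n).size ≤ p.eval n ∧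
              ((E n).gates.map fun g => if g.fn ∈ acBasis then 0 else g.arity).sum ≤ w n) ∧
          E.Decides PARITY := by
  rintro ⟨E, hE, hdec⟩
  -- constants
  obtain ⟨K, hK⟩ := natPoly_exists_le_pow (p + Polynomial.X + 2)
  set c₁ : ℕ := ACForm.cB ^ (d + 2) with hc₁
  set k : ℕ := 6 * K with hk
  -- a large length `n`
  have e1 := eventually_ge_atTop 2
  have e2 : ∀ᶠ n : ℕ in atTop, w n ≤ n := (hw.and e1).mono fun n h => by
    obtain ⟨h, hn⟩ := h
    have hL : 1 ≤ Nat.log 2 n := Nat.le_log_of_pow_le one_lt_two (by simpa using hn)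
    calc w n = w n * 1 := (mul_one _).symm
      _ ≤ w n * Nat.log 2 n ^ (d + 1) := Nat.mul_le_mul_left _ (Nat.one_le_pow _ _ hL)
      _ ≤ n := h
  have e4 := eventually_mul_log_pow_le (3 * (c₁ * k ^ d * (3 * (d + 2)))) d
  have e5 : ∀ᶠ n : ℕ in atTop, 3 * (2 * c₁ * k ^ d) ≤ Nat.log 2 n :=
    (eventually_ge_atTop (2 ^ (3 * (2 * c₁ * k ^ d)))).mono fun n hn =>
      Nat.le_log_of_pow_le one_lt_two hn
  obtain ⟨n, hn2, hwn, hwL, hpl, hL⟩ := (e1.and (e2.and (hw.and (e4.and e5)))).exists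
  obtain ⟨hdep, hsize, hwire⟩ := hE n
  -- the inequality at length `n`
  have main := main_ineq (show 1 ≤ n by omega) (E n) hdep hsize hwire (eval_eq_parityFn hdec)
  -- bounding `ℓ`
  have hT : p.eval n + n + 2 ≤ n ^ K := by
    have := hK n hn2
    simpa [Polynomial.eval_add] using this
  have hs₁ : 2 * ((w n + 1) * (p.eval n + 1) + 1) + 1 ≤ n ^ (3 * K) := by
    set T := p.eval n + n + 2 with hTdef
    have hT3 : 3 ≤ T := by omega
    have hw1 : w n + 1 ≤ T := by omega
    have hp1 : p.eval n + 1 ≤ T := by omega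
    have hTT : 9 ≤ T * T := Nat.mul_le_mul hT3 hT3
    have hTTT : 3 * (T * T) ≤ T * T * T := by
      rw [mul_comm (T * T) T]; exact Nat.mul_le_mul_right _ hT3
    calc 2 * ((w n + 1) * (p.eval n + 1) + 1) + 1 ≤ 2 * (T * T + 1) + 1 := by
          have := Nat.mul_le_mul hw1 hp1; omega
      _ ≤ T * T * T := by omega
      _ = T ^ 3 := by ring
      _ ≤ (n ^ K) ^ 3 := Nat.pow_le_pow_left hT 3
      _ = n ^ (3 * K) := by rw [← pow_mul, mul_comm]
  have hℓ : Nat.log 2 (2 * ((w n + 1) * (p.eval n + 1) + 1) + 1) ≤ k * Nat.log 2 n := by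
    have hL1 : 1 ≤ Nat.log 2 n := Nat.le_log_of_pow_le one_lt_two (by simpa using hn2)
    calc Nat.log 2 (2 * ((w n + 1) * (p.eval n + 1) + 1) + 1) ≤ Nat.log 2 (n ^ (3 * K)) :=
          Nat.log_mono_right hs₁
      _ ≤ 3 * K * (Nat.log 2 n + 1) := log_two_pow_le n (3 * K)
      _ ≤ 3 * K * (2 * Nat.log 2 n) := Nat.mul_le_mul_left _ (by omega)
      _ = k * Nat.log 2 n := by rw [hk]; ring
  exact endgame (show 1 ≤ n by omega) main hℓ hwL hpl hL

/-! ### The wire budget is load-bearing: the boundary instance `w(n) = n` -/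

/-- **E3^𝒪 without its wire-budget hypothesis is false** (boundary instance of the barrier
fact): with `𝒪 = PARITY`, depth `1`, size bound the constant polynomial `1` and budget
`w(n) = n`, the family of one-gate oracle circuits `oracleOnlyCircuit PARITY n` (a single
`PARITY`-gate of fan-in `n` reading all inputs) meets every structural clause of
`Locality_parityLocalizes` and decides `PARITY`. So the hypothesis
"`w(n) ⌊log₂ n⌋^j ≤ n` eventually, for every `j`" cannot be dropped (nor weakened to `j = 0`).
[cite: arXiv191108297, Def. 11 (§2.5) and Prop. 50 (E3^𝒪), p. 27] -/
theorem Locality_parityLocalizes_false_without_wireBudget :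
    ¬ ∀ (𝒪 : Language Bool) (d : ℕ) (p : Polynomial ℕ) (w : ℕ → ℕ),
      ¬ ∃ E : CircuitFamily,
        (∀ n, (E n).IsOver (acBasis ∪ {g | ∃ m : ℕ, g = ⟨m, 𝒪.sliceFn m⟩}) ∧
            (E n).acDepth ≤ d ∧ (E n).size ≤ p.eval n ∧
              ((E n).gates.map fun g => if g.fn ∈ acBasis then 0 else g.arity).sum ≤ w n) ∧
          E.Decides PARITY := by
  intro h
  refine h PARITY 1 1 (fun n => n) ⟨fun n => oracleOnlyCircuit PARITY n, fun n => ⟨?_, ?_, ?_, ?_⟩, ?_⟩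
  · exact (isLocalAC_oracleOnlyCircuit PARITY n).1
  · exact (isLocalAC_oracleOnlyCircuit PARITY n).2.1
  · rw [Polynomial.eval_one]; exact (isLocalAC_oracleOnlyCircuit PARITY n).2.2.1
  · simp only [oracleOnlyCircuit, List.map_cons, List.map_nil, List.sum_cons, List.sum_nil,
      add_zero]
    split <;> omega
  · intro x
    rw [eval_oracleOnlyCircuit]
    show PARITY.boolIndicator (List.ofFn x.get) = PARITY.boolIndicator x
    rw [List.ofFn_get]

/-! ### The other side of the threshold: parity at depth `3` with total oracle fan-in `n/(2 log₂ n)` -/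

namespace ParityUpper

variable {n : ℕ}

/-- `PARITY`'s indicator is the parity function. [folklore] -/
theorem PARITY_boolIndicator (z : List Bool) : PARITY.boolIndicator z = parityFn z.length z.get := by
  by_cases hz : z ∈ PARITY
  · rw [(Set.mem_iff_boolIndicator _ _).1 hz]
    exact (show parityFn z.length z.get = true from hz).symm
  · rw [(Set.notMem_iff_boolIndicator _ _).1 hz]
    exact (Bool.eq_false_iff.2 (show parityFn z.length z.get ≠ true from hz)).symm

/-- The slices of the language `PARITY` are the parity functions. [folklore] -/
theorem PARITY_sliceFn (m : ℕ) (v : Fin m → Bool) : PARITY.sliceFn m v = parityFn m v := by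
  have key : ∀ (z : List Bool) (N : ℕ) (hz : z.length = N),
      PARITY.boolIndicator z = parityFn N (fun i => z.get (i.cast hz.symm)) := by
    rintro z _ rfl
    exact PARITY_boolIndicator z
  show PARITY.boolIndicator (List.ofFn v) = _
  rw [key (List.ofFn v) m (List.length_ofFn ..)]
  congr 1
  funext i
  simp

/-- Total oracle fan-in of a circuit with `≤ q` gates outside `acBasis`, each of fan-in `≤ ℓ`. [folklore] -/
theorem sum_oracleFanIn_le {ι : Type*} (l : List (Gate ι)) (q ℓ : ℕ)
    (hq : l.countP (fun g => g.fn ∉ acBasis) ≤ q)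
    (hℓ : ∀ g ∈ l, g.fn ∉ acBasis → g.arity ≤ ℓ) :
    (l.map fun g => if g.fn ∈ acBasis then 0 else g.arity).sum ≤ q * ℓ := by
  induction l generalizing q with
  | nil => simp
  | cons g l ih =>
    simp only [List.map_cons, List.sum_cons]
    rw [List.countP_cons] at hq
    have hℓ' : ∀ g' ∈ l, g'.fn ∉ acBasis → g'.arity ≤ ℓ := fun g' hg' =>
      hℓ g' (List.mem_cons_of_mem _ hg')
    by_cases hg : g.fn ∈ acBasis
    · rw [if_pos hg, zero_add]
      refine ih q ?_ hℓ'
      simpa [hg] using hq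
    · rw [if_neg hg]
      have hq' : l.countP (fun g => g.fn ∉ acBasis) + 1 ≤ q := by simpa [hg] using hq
      have hga : g.arity ≤ ℓ := hℓ g (List.mem_cons.2 (Or.inl rfl)) hg
      have hrest := ih (q - 1) (by omega) hℓ'
      have hq1 : 1 ≤ q := by omega
      calc g.arity + (l.map fun g => if g.fn ∈ acBasis then 0 else g.arity).sum
          ≤ ℓ + (q - 1) * ℓ := Nat.add_le_add hga hrest
        _ = ((q - 1) + 1) * ℓ := by ring
        _ = q * ℓ := by rw [Nat.sub_add_cancel hq1]

/-- A literal pattern test on one coordinate is a literal (depth `0`, `≤ 1` gate). [folklore] -/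
theorem acReal_lit (T : Finset (Fin n)) (i : Fin n) :
    ACReal (fun x : Fin n → Bool => if i ∈ T then x i else !x i) 0 1 := by
  by_cases hi : i ∈ T
  · exact ((acReal_input (ι := Fin n) i).mono le_rfl zero_le_one).congr fun x => by rw [if_pos hi]
  · exact (acReal_notInput (ι := Fin n) i).congr fun x => by rw [if_neg hi]

/-- "The true coordinates of `x` inside `S` are exactly `T`" is an `∧` of `|S|` literals
(depth `1`, `|S| + 1` gates). [folklore] -/
theorem acReal_pattern (S T : Finset (Fin n)) :
    ACReal (fun x : Fin n → Bool => decide (∀ i ∈ S, x i = decide (i ∈ T))) 1 (S.card + 1) := by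
  have h : ∀ k : ↥S, ACReal (fun x : Fin n → Bool => if (k : Fin n) ∈ T then x k else !x k) 0 1 :=
    fun k => acReal_lit T k
  have := acReal_forall_fintype h
  rw [Fintype.card_coe, mul_one] at this
  refine this.congr fun x => ?_
  simp only [decide_eq_decide]
  constructor
  · intro H i hi
    have h1 : (if i ∈ T then x i else !x i) = true := H ⟨i, hi⟩
    by_cases hiT : i ∈ T
    · rw [if_pos hiT] at h1
      rw [h1, decide_eq_true hiT]
    · rw [if_neg hiT] at h1
      rw [decide_eq_false hiT]
      simpa using h1
  · intro H k
    have h1 := H k k.2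
    show (if (k : Fin n) ∈ T then x k else !x k) = true
    by_cases hkT : (k : Fin n) ∈ T
    · rw [if_pos hkT, h1, decide_eq_true hkT]
    · rw [if_neg hkT, h1, decide_eq_false hkT]; rfl

/-- **Odd weight on a block is a DNF**: "`x` has an odd number of ones in `S`" is an `∨` over
the odd subsets `T ⊆ S` of the pattern tests (depth `2`, `2^{|S|}(|S|+1) + 1` gates). [folklore] -/
theorem acReal_oddCard (S : Finset (Fin n)) :
    ACReal (fun x : Fin n → Bool => decide ((S.filter fun i => x i = true).card % 2 = 1)) 2
      (2 ^ S.card * (S.card + 1) + 1) := by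
  have h : ∀ T : ↥S.powerset, ACReal (fun x : Fin n → Bool =>
      if (T : Finset (Fin n)).card % 2 = 1 then decide (∀ i ∈ S, x i = decide (i ∈ (T : Finset (Fin n))))
      else false) 1 (S.card + 1) := by
    intro T
    by_cases hT : (T : Finset (Fin n)).card % 2 = 1
    · exact (acReal_pattern S T).congr fun x => by rw [if_pos hT]
    · exact ((acReal_const (ι := Fin n) false).mono le_rfl (Nat.le_add_left 1 _)).congr
        fun x => by rw [if_neg hT]
  have := acReal_exists_fintype h
  rw [Fintype.card_coe, Finset.card_powerset] at this
  refine this.congr fun x => ?_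
  simp only [decide_eq_decide]
  constructor
  · rintro ⟨T, hT⟩
    by_cases hodd : (T : Finset (Fin n)).card % 2 = 1
    · rw [if_pos hodd] at hT
      have hmatch := of_decide_eq_true hT
      have heq : S.filter (fun i => x i = true) = (T : Finset (Fin n)) := by
        ext i
        simp only [Finset.mem_filter]
        constructor
        · rintro ⟨hiS, hxi⟩
          have h1 := hmatch i hiS
          rw [hxi] at h1
          exact of_decide_eq_true h1.symm
        · intro hiT
          have hiS : i ∈ S := Finset.mem_powerset.1 T.2 hiT
          exact ⟨hiS, by rw [hmatch i hiS]; exact decide_eq_true hiT⟩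
      rw [heq]
      exact hodd
    · rw [if_neg hodd] at hT
      exact absurd hT Bool.false_ne_true
  · intro hodd
    refine ⟨⟨S.filter fun i => x i = true, Finset.mem_powerset.2 (Finset.filter_subset _ _)⟩, ?_⟩
    show (if (S.filter fun i => x i = true).card % 2 = 1
      then decide (∀ i ∈ S, x i = decide (i ∈ S.filter fun i => x i = true)) else false) = true
    rw [if_pos hodd]
    refine decide_eq_true fun i hiS => ?_
    by_cases hxi : x i = true
    · rw [hxi]
      exact (decide_eq_true (Finset.mem_filter.2 ⟨hiS, hxi⟩)).symm
    · have hxi' : x i = false := by simpa using hxi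
      rw [hxi']
      symm
      exact decide_eq_false fun hmem => hxi (Finset.mem_filter.1 hmem).2

/-- **Parity of the block parities is the parity** (blocks = fibres of `blk`). [folklore] -/
theorem parityFn_blocks {B : ℕ} (blk : Fin n → Fin B) (x : Fin n → Bool) :
    parityFn B (fun j => decide ((((univ : Finset (Fin n)).filter fun i => blk i = j).filter
        fun i => x i = true).card % 2 = 1)) = parityFn n x := by
  simp only [parityFn, GateFn.numOnes, decide_eq_decide, decide_eq_true_eq]
  set c : Fin B → ℕ := fun j =>
    ((((univ : Finset (Fin n)).filter fun i => blk i = j).filter fun i => x i = true)).card with hc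
  have hsum : ((univ : Finset (Fin n)).filter fun i => x i = true).card = ∑ j, c j := by
    rw [Finset.card_eq_sum_card_fiberwise (f := blk) (t := univ) fun i _ => Finset.mem_univ _]
    refine Finset.sum_congr rfl fun j _ => ?_
    rw [hc]
    simp only [Finset.filter_filter]
    congr 1
    ext i
    simp only [Finset.mem_filter, Finset.mem_univ, true_and]
    exact and_comm
  have hcard : ((univ : Finset (Fin B)).filter fun j => c j % 2 = 1).card = ∑ j, c j % 2 := by
    rw [Finset.card_filter]
    refine Finset.sum_congr rfl fun j _ => ?_
    rcases Nat.mod_two_eq_zero_or_one (c j) with h | h <;> simp [h]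
  show ((univ : Finset (Fin B)).filter fun j => c j % 2 = 1).card % 2 = 1 ↔
    ((univ : Finset (Fin n)).filter fun i => x i = true).card % 2 = 1
  rw [hsum, hcard, ← Finset.sum_nat_mod]

/-- **Parity with one oracle gate of fan-in `B`** (the upper-bound side of E3^𝒪): cut the `n`
variables into the `B` fibres of `blk`, each of size `≤ t`; compute each block's parity by a
DNF (depth `2`, `≤ 2^t (t+1) + 1` gates) side by side, and feed the `B` block parities to ONE
`PARITY`-gate: a `[1, B, 1]`-local depth-`3` circuit of size `≤ B (2^t (t+1) + 1) + 1` for the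
oracle `PARITY` computing `parityFn n`. [cite: arXiv191108297, Def. 11 (§2.5) and §5.1.5
(discussion after Prop. 50), p. 27] -/
theorem exists_localAC_parity {B : ℕ} (blk : Fin n → Fin B) (t : ℕ)
    (ht : ∀ j, ((univ : Finset (Fin n)).filter fun i => blk i = j).card ≤ t) :
    ∃ E : Circuit (Fin n), E.IsLocalAC PARITY 3 (B * (2 ^ t * (t + 1) + 1) + 1) 1 B ∧
      E.Computes (parityFn n) := by
  have hblocks : ∀ j : Fin B, ACReal (fun x : Fin n → Bool =>
      decide ((((univ : Finset (Fin n)).filter fun i => blk i = j).filter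
        fun i => x i = true).card % 2 = 1)) 2 (2 ^ t * (t + 1) + 1) := fun j =>
    (acReal_oddCard _).mono le_rfl (Nat.add_le_add_right
      (Nat.mul_le_mul (Nat.pow_le_pow_right two_pos (ht j)) (Nat.succ_le_succ (ht j))) 1)
  have hvec := acVec_ofBlocks hblocks
  rw [Finset.sum_const, Finset.card_univ, Fintype.card_fin, smul_eq_mul] at hvec
  obtain ⟨E, hE, hcomp⟩ := Locality.exists_isLocalAC_of_acVec hvec PARITY
  refine ⟨E, hE, fun x => (hcomp x).trans ?_⟩
  show PARITY.sliceFn B _ = parityFn n x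
  rw [PARITY_sliceFn]
  exact parityFn_blocks blk x

end ParityUpper

open ParityUpper in
/-- **The `ω(1)` in E3^𝒪 cannot be replaced by `1` (proved; the upper-bound side of the
threshold).** There are an oracle (`PARITY` itself), a polynomial size bound
(`14 (n+1)^4`) and a wire budget `w` with `w(n) · ⌊log₂ n⌋ ≤ n` for ALL `n` — namely
`w(n) = ⌊(n-1)/(2(⌊log₂ n⌋+1))⌋ + 1 ≈ n/(2 log₂ n)` — such that a family of DEPTH-`3` circuits
over `∧, ∨, ¬` and `PARITY`-gates of total oracle fan-in `≤ w(n)` decides `PARITY`: blocks of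
`2(⌊log₂ n⌋+1)` consecutive variables, block parities by DNFs, one `PARITY`-gate on the block
parities (`ParityUpper.exists_localAC_parity`). Together with `Locality_parityLocalizes_sharp`
(budget `n/(log₂ n)^{d+1}` suffices for the lower bound at depth `d`) this brackets, at depth
`3`, the exponent of `log n` at which the localized parity bound stops holding between `1` and
`4`; in general the random-restriction lower bound localizes for total oracle fan-in
`n/(log n)^{Θ(d)}` and not beyond, which is why print states E3^𝒪 with `n/(log n)^{ω(1)}`
uniformly in the (constant) depth. [cite: arXiv191108297, Prop. 50 (E3^𝒪) and the discussion
after its proof, p. 27] -/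
theorem Locality_parityLocalizes_false_at_logBudget :
    ∃ (𝒪 : Language Bool) (p : Polynomial ℕ) (w : ℕ → ℕ),
      (∀ᶠ n : ℕ in atTop, w n * Nat.log 2 n ≤ n) ∧
      ∃ E : CircuitFamily,
        (∀ n, (E n).IsOver (acBasis ∪ {g | ∃ m : ℕ, g = ⟨m, 𝒪.sliceFn m⟩}) ∧
            (E n).acDepth ≤ 3 ∧ (E n).size ≤ p.eval n ∧
              ((E n).gates.map fun g => if g.fn ∈ acBasis then 0 else g.arity).sum ≤ w n) ∧
          E.Decides PARITY := by
  -- block length `t(n) = 2(⌊log₂ n⌋ + 1)`, number of blocks `B(n) = ⌊(n-1)/t(n)⌋ + 1`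
  have key : ∀ n : ℕ, ∃ E : Circuit (Fin n),
      E.IsLocalAC PARITY 3 (((n - 1) / (2 * (Nat.log 2 n + 1)) + 1) *
          (2 ^ (2 * (Nat.log 2 n + 1)) * (2 * (Nat.log 2 n + 1) + 1) + 1) + 1) 1
        ((n - 1) / (2 * (Nat.log 2 n + 1)) + 1) ∧ E.Computes (parityFn n) := by
    intro n
    have htpos : 0 < 2 * (Nat.log 2 n + 1) := by omega
    have hblk : ∀ i : Fin n, i.1 / (2 * (Nat.log 2 n + 1)) < (n - 1) / (2 * (Nat.log 2 n + 1)) + 1 :=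
      fun i => Nat.lt_succ_of_le (Nat.div_le_div_right (by omega))
    refine exists_localAC_parity (fun i : Fin n => ⟨i.1 / (2 * (Nat.log 2 n + 1)), hblk i⟩)
      (2 * (Nat.log 2 n + 1)) fun j => ?_
    calc ((univ : Finset (Fin n)).filter fun i : Fin n =>
            (⟨i.1 / (2 * (Nat.log 2 n + 1)), hblk i⟩ : Fin _) = j).card
        ≤ (Finset.range (2 * (Nat.log 2 n + 1))).card := by
          refine Finset.card_le_card_of_injOn (fun i : Fin n => i.1 % (2 * (Nat.log 2 n + 1)))
            (fun i _ => Finset.mem_coe.2 (Finset.mem_range.2 (Nat.mod_lt _ htpos))) ?_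
          intro i hi i' hi' hmod
          have hq : i.1 / (2 * (Nat.log 2 n + 1)) = i'.1 / (2 * (Nat.log 2 n + 1)) := by
            have h1 := congrArg Fin.val (Finset.mem_filter.1 (Finset.mem_coe.1 hi)).2
            have h2 := congrArg Fin.val (Finset.mem_filter.1 (Finset.mem_coe.1 hi')).2
            exact h1.trans h2.symm
          apply Fin.ext
          rw [← Nat.div_add_mod i.1 (2 * (Nat.log 2 n + 1)), ← Nat.div_add_mod i'.1 (2 * (Nat.log 2 n + 1)),
            hq]
          exact congrArg _ hmod
      _ = 2 * (Nat.log 2 n + 1) := Finset.card_range _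
  choose E hE using key
  -- two elementary bounds on `L = ⌊log₂ n⌋`: `2^L ≤ n + 1` and `2L ≤ n`
  have two_pow_log_le_succ : ∀ n : ℕ, 2 ^ Nat.log 2 n ≤ n + 1 := fun n => by
    rcases Nat.eq_zero_or_pos n with rfl | hn
    · simp
    · exact (Nat.pow_log_le_self 2 hn.ne').trans (Nat.le_succ n)
  have two_mul_log_le : ∀ n : ℕ, 2 * Nat.log 2 n ≤ n := fun n => by
    rcases Nat.eq_zero_or_pos n with rfl | hn
    · simp
    · have h1 : ∀ L : ℕ, 2 * L ≤ 2 ^ L := by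
        intro L
        induction L with
        | zero => simp
        | succ k ih =>
          have hk : k + 1 ≤ 2 ^ k := Nat.lt_two_pow_self
          calc 2 * (k + 1) ≤ 2 * 2 ^ k := Nat.mul_le_mul_left 2 hk
            _ = 2 ^ (k + 1) := by ring
      exact (h1 _).trans (Nat.pow_log_le_self 2 hn.ne')
  refine ⟨PARITY, Polynomial.C 14 * (Polynomial.X + 1) ^ 4,
    fun n => (n - 1) / (2 * (Nat.log 2 n + 1)) + 1, Eventually.of_forall fun n => ?_,
    E, fun n => ⟨(hE n).1.1, (hE n).1.2.1, (hE n).1.2.2.1.trans ?_, ?_⟩, fun x => ?_⟩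
  · -- the budget: `(⌊(n-1)/(2(L+1))⌋ + 1) L ≤ n`
    set L := Nat.log 2 n with hL
    set q := (n - 1) / (2 * (L + 1)) with hq
    have h1 : q * (2 * (L + 1)) ≤ n - 1 := Nat.div_mul_le_self _ _
    have h2 : 2 * L ≤ n := two_mul_log_le n
    have e1 : q * (2 * (L + 1)) = 2 * (q * L) + 2 * q := by ring
    have e2 : (q + 1) * L = q * L + L := by ring
    rw [e1] at h1
    rw [e2]
    omega
  · -- the size: `B (2^t (t+1) + 1) + 1 ≤ 14 (n+1)^4`
    set L := Nat.log 2 n with hL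
    simp only [Polynomial.eval_mul, Polynomial.eval_C, Polynomial.eval_pow, Polynomial.eval_add,
      Polynomial.eval_X, Polynomial.eval_one]
    have hB : (n - 1) / (2 * (L + 1)) + 1 ≤ n + 1 :=
      Nat.succ_le_succ ((Nat.div_le_self _ _).trans (Nat.sub_le n 1))
    have hpow : 2 ^ (2 * (L + 1)) ≤ 4 * (n + 1) ^ 2 := by
      have h := two_pow_log_le_succ n
      calc 2 ^ (2 * (L + 1)) = (2 ^ L * 2) ^ 2 := by ring
        _ ≤ ((n + 1) * 2) ^ 2 := Nat.pow_le_pow_left (Nat.mul_le_mul_right 2 h) 2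
        _ = 4 * (n + 1) ^ 2 := by ring
    have ht1 : 2 * (L + 1) + 1 ≤ 3 * (n + 1) := by
      have := two_mul_log_le n
      omega
    have h3 : 2 ^ (2 * (L + 1)) * (2 * (L + 1) + 1) + 1 ≤ 13 * (n + 1) ^ 3 := by
      have hm := Nat.mul_le_mul hpow ht1
      have hcube : 1 ≤ (n + 1) ^ 3 := Nat.one_le_pow _ _ (Nat.succ_pos n)
      calc 2 ^ (2 * (L + 1)) * (2 * (L + 1) + 1) + 1 ≤ 4 * (n + 1) ^ 2 * (3 * (n + 1)) + 1 :=
            Nat.add_le_add_right hm 1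
        _ = 12 * (n + 1) ^ 3 + 1 := by ring
        _ ≤ 13 * (n + 1) ^ 3 := by omega
    have hm := Nat.mul_le_mul hB h3
    have hq : 1 ≤ (n + 1) ^ 4 := Nat.one_le_pow _ _ (Nat.succ_pos n)
    calc ((n - 1) / (2 * (L + 1)) + 1) * (2 ^ (2 * (L + 1)) * (2 * (L + 1) + 1) + 1) + 1
        ≤ (n + 1) * (13 * (n + 1) ^ 3) + 1 := Nat.add_le_add_right hm 1
      _ = 13 * (n + 1) ^ 4 + 1 := by ring
      _ ≤ 14 * (n + 1) ^ 4 := by omega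
  · -- the wire budget: one gate outside `acBasis`, of fan-in `B`
    have := sum_oracleFanIn_le (E n).gates 1 _ (hE n).1.2.2.2.1 (hE n).1.2.2.2.2
    rwa [one_mul] at this
  · -- deciding `PARITY`
    rw [(hE x.length).2 x.get, PARITY_boolIndicator]

end Literature.Barriers.PneNP

end
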